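import Summits.Ventures.HSemireg.WedgeHankelRecurrenceGaussTopPerturbation

/-!
# Venture HSemireg — **LAGUERRE'S INEQUALITY `P P'' < (P')²` FOR A POLYNOMIAL WITH SIMPLE REAL ZEROS, AND FOR EVERY `q_n` OF A POSITIVE RECURRENCE**: with `P = ∏_i (X − z_i)` and
# `P_i = ∏_{j ≠ i} (X − z_j)`, the polynomial identity `(P')² − P P'' = Σ_i P_i²` (the logarithmic derivative `P'∕P = Σ 1∕(X − z_i)` has derivative `−Σ 1∕(X − z_i)²`), whose right side
# is strictly positive everywhere when the `z_i` are distinct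

HONEST FRAMING. Part of the Lean index of the computation cell `pub-hsemireg` (seat p10 gen 44, Sunday typer «UNIFORM-IN-n»).  Real polynomials (`Polynomial.derivative`) and finite sums only; no
variety, no cohomology theory, no sheaf, no Ext group and no semiregularity map is constructed here; nothing here says that HC / HC_CM / HC_AV holds; no Literature fact (unproved `Prop`) is declared
or used.  Custodian versions as in `WedgeHankelSiegelIdeal` (1/3).
SOURCES (cited).  E. Laguerre, *Sur les fonctions du genre zéro et du genre un*, C. R. Acad. Sci. 95 (1882) 828–831 (Œuvres I, 174–177); G. Pólya, G. Szegő, *Problems and Theorems in Analysis II*,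
Part V Problem 58; Q. I. Rahman, G. Schmeisser, *Analytic Theory of Polynomials* (2002) §2.5 (the Laguerre inequality `p p'' − p'² ≤ 0` for real-rooted `p`); G. Szegő, *Orthogonal Polynomials*,
Thm 3.3.1 (real simple zeros of orthogonal polynomials).
PROOF TYPED HERE.  `P' = Σ_i P_i` and `P'' = Σ_i Σ_{j≠i} P_{ij}` by `Polynomial.derivative_prod_finset`; `P_i P_j = P P_{ij}` (`i ≠ j`); so `(Σ P_i)² = Σ P_i² + Σ_{i≠j} P P_{ij}`.  Positivity: at a point
`x` at most the factors `X − z_m` with `z_m = x` vanish, and `P_m(x) ≠ 0` for that `m` (distinct zeros); otherwise every `P_i(x) ≠ 0`.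
DEDUP DISCLOSURE (`rg -n -i 'laguerre_ineq|derivative_sq_sub|logDeriv' Summits/Ventures/HSemireg Literature/Algebra`, 2026-09-03): N274 `recurrence_root_simple` and N284
`eval_derivative_prod_X_sub_C_at_node` are the nearest items; the identity and the inequality are new in the tree.  The 6 names below: 0 hits tree-wide.

WHAT IS IN THE TREE.  N279 `recurrence_zeros_interlace` (zeros of `q_{m+1}`); Mathlib `Polynomial.derivative_prod_finset`, `Finset.prod_erase_mul`, `Finset.mul_prod_erase`, `Finset.add_sum_erase`,
`Finset.erase_right_comm`.
THIS FILE (namespace `Summit.Ventures.HSemireg.Wedge.HankelOuter` continued; CHAINED on N333 (import only), N279; 0 definitions):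
* §1099 `derivative_prod_X_sub_C_eq_sum` (`P' = Σ P_i`), `derivative_two_prod_X_sub_C_eq_sum` (`P'' = Σ_i Σ_{j≠i} P_{ij}`), **`derivative_sq_sub_mul_derivative_two`** (`(P')² − P P'' = Σ P_i²`),
  `sum_sq_cofactor_eval_pos` (`Σ P_i(x)² > 0`, distinct zeros, `n ≥ 1`), **`laguerre_inequality_prod`** (`P(x) P''(x) < P'(x)²` for all real `x`), **`laguerre_inequality_recurrence`** (the same
  for every `q_{m+1}` of a positive recurrence; in particular `q_{m+1}` and `q''_{m+1}` have opposite signs at the zeros of `q'_{m+1}`).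
CAVEATS.  Distinct real zeros; `n ≥ 1`.  Nothing Ext-side.  New names only.
-/

open Module Polynomial
open scoped Matrix Polynomial

namespace Summit.Ventures.HSemireg.Wedge.HankelOuter

/-! ## §1099. Laguerre's inequality -/

/-- **`P' = Σ_i P_i`** for `P = ∏_i (X − z_i)`, `P_i = ∏_{j ≠ i} (X − z_j)`. [bookkeeping; this file, §1099] -/
theorem derivative_prod_X_sub_C_eq_sum {n : ℕ} (z : Fin n → ℝ) :
    derivative (∏ i, (Polynomial.X - C (z i))) = ∑ i, ∏ j ∈ Finset.univ.erase i, (Polynomial.X - C (z j)) := by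
  rw [derivative_prod_finset]
  exact Finset.sum_congr rfl fun i _ => by rw [derivative_sub, derivative_X, derivative_C, sub_zero, mul_one]

/-- **`P'' = Σ_i Σ_{j ≠ i} P_{ij}`**, `P_{ij} = ∏_{l ≠ i, j} (X − z_l)`. [bookkeeping; this file, §1099] -/
theorem derivative_two_prod_X_sub_C_eq_sum {n : ℕ} (z : Fin n → ℝ) :
    derivative (derivative (∏ i, (Polynomial.X - C (z i)))) = ∑ i, ∑ j ∈ Finset.univ.erase i, ∏ l ∈ (Finset.univ.erase i).erase j, (Polynomial.X - C (z l)) := by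
  rw [derivative_prod_X_sub_C_eq_sum, derivative_sum]
  refine Finset.sum_congr rfl fun i _ => ?_
  rw [derivative_prod_finset]
  exact Finset.sum_congr rfl fun j _ => by rw [derivative_sub, derivative_X, derivative_C, sub_zero, mul_one]

/-- **THE IDENTITY `(P')² − P P'' = Σ_i P_i²`** (`P_i P_j = P P_{ij}` for `i ≠ j`). [Laguerre 1882; Pólya–Szegő V.58; this file, §1099] -/
theorem derivative_sq_sub_mul_derivative_two {n : ℕ} (z : Fin n → ℝ) :
    (derivative (∏ i, (Polynomial.X - C (z i)))) ^ 2 - (∏ i, (Polynomial.X - C (z i))) * derivative (derivative (∏ i, (Polynomial.X - C (z i)))) =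
      ∑ i, (∏ j ∈ Finset.univ.erase i, (Polynomial.X - C (z j))) ^ 2 := by
  rw [derivative_two_prod_X_sub_C_eq_sum, derivative_prod_X_sub_C_eq_sum, sq, Finset.sum_mul_sum, Finset.mul_sum, ← Finset.sum_sub_distrib]
  refine Finset.sum_congr rfl fun i _ => ?_
  -- split the inner sum at `j = i`; the off-diagonal terms are `P · P_{ij}`
  rw [← Finset.add_sum_erase Finset.univ _ (Finset.mem_univ i), Finset.mul_sum, sq, add_sub_assoc, add_eq_left, sub_eq_zero]
  refine Finset.sum_congr rfl fun j hj => ?_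
  have hji : j ≠ i := (Finset.mem_erase.1 hj).1
  have hi : i ∈ Finset.univ.erase j := Finset.mem_erase.2 ⟨hji.symm, Finset.mem_univ i⟩
  rw [← Finset.mul_prod_erase _ (fun l => Polynomial.X - C (z l)) hi, Finset.erase_right_comm, ← mul_assoc,
    Finset.prod_erase_mul _ (fun l => Polynomial.X - C (z l)) (Finset.mem_univ i)]

/-- **`Σ_i P_i(x)² > 0` at every real `x`** when the `z_i` are distinct and `n ≥ 1`. [this file, §1099] -/
theorem sum_sq_cofactor_eval_pos {n : ℕ} {z : Fin (n + 1) → ℝ} (hz : Function.Injective z) (x : ℝ) :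
    0 < ∑ i, ((∏ j ∈ Finset.univ.erase i, (Polynomial.X - C (z j))).eval x) ^ 2 := by
  -- an index `m` with `P_m(x) ≠ 0`: the one with `z_m = x` if any, else `0`
  have hexists : ∃ m : Fin (n + 1), (∏ j ∈ Finset.univ.erase m, (Polynomial.X - C (z j))).eval x ≠ 0 := by
    by_cases h : ∃ m, z m = x
    · obtain ⟨m, hm⟩ := h
      refine ⟨m, ?_⟩
      rw [eval_prod]
      refine Finset.prod_ne_zero_iff.2 fun j hj => ?_
      rw [eval_sub, eval_X, eval_C, ← hm, sub_ne_zero]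
      exact fun h' => (Finset.mem_erase.1 hj).1 (hz h'.symm)
    · push Not at h
      refine ⟨0, ?_⟩
      rw [eval_prod]
      exact Finset.prod_ne_zero_iff.2 fun j _ => by rw [eval_sub, eval_X, eval_C, sub_ne_zero]; exact fun h' => h j h'.symm
  obtain ⟨m, hm⟩ := hexists
  exact lt_of_lt_of_le (sq_pos_iff.2 hm) (Finset.single_le_sum (f := fun i => ((∏ j ∈ Finset.univ.erase i, (Polynomial.X - C (z j))).eval x) ^ 2)
    (fun i _ => sq_nonneg _) (Finset.mem_univ m))

/-- **LAGUERRE'S INEQUALITY: `P(x)·P''(x) < P'(x)²` at every real `x` for `P = ∏ (X − z_i)` with distinct `z_i` (`n ≥ 1`).** [Laguerre 1882; Rahman–Schmeisser §2.5; this file, §1099] -/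
theorem laguerre_inequality_prod {n : ℕ} {z : Fin (n + 1) → ℝ} (hz : Function.Injective z) (x : ℝ) :
    (∏ i, (Polynomial.X - C (z i))).eval x * (derivative (derivative (∏ i, (Polynomial.X - C (z i))))).eval x <
      ((derivative (∏ i, (Polynomial.X - C (z i)))).eval x) ^ 2 := by
  have h := congrArg (fun Q : ℝ[X] => Q.eval x) (derivative_sq_sub_mul_derivative_two z)
  simp only [eval_sub, eval_pow, eval_mul, eval_finsetSum] at h
  have hpos := sum_sq_cofactor_eval_pos hz x
  linarith

/-- **LAGUERRE'S INEQUALITY FOR THE RECURRENCE: `q_{m+1}(x) q''_{m+1}(x) < q'_{m+1}(x)²` at every real `x`** (positive recurrence, simple real zeros by N279); hence `q_{m+1}` and `q''_{m+1}` have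
opposite signs at every zero of `q'_{m+1}`. [Laguerre 1882; Szegő Thm 3.3.1; this file, §1099] -/
theorem laguerre_inequality_recurrence {q : ℕ → ℝ[X]} {a b : ℕ → ℝ} (hq0 : q 0 = 1) (hq1 : q 1 = Polynomial.X - C (a 0))
    (hrec : ∀ n, q (n + 2) = (Polynomial.X - C (a (n + 1))) * q (n + 1) - C (b (n + 1)) * q n) (hb : ∀ j, 0 < b j) (m : ℕ) (x : ℝ) :
    (q (m + 1)).eval x * (derivative (derivative (q (m + 1)))).eval x < ((derivative (q (m + 1))).eval x) ^ 2 ∧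
      ((derivative (q (m + 1))).eval x = 0 → (q (m + 1)).eval x * (derivative (derivative (q (m + 1)))).eval x < 0) := by
  obtain ⟨z, y, hz, -, hzq, -, -⟩ := recurrence_zeros_interlace hq0 hq1 hrec hb m
  have h := laguerre_inequality_prod hz.injective x
  rw [← hzq] at h
  exact ⟨h, fun h0 => by rw [h0] at h; simpa using h⟩

end Summit.Ventures.HSemireg.Wedge.HankelOuter
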